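import Summits.MatrixMultiplication.MatrixMultiplication.Theorems.AbelianSTPPCensusTAKnap575Sound
import Summits.MatrixMultiplication.MatrixMultiplication.Theorems.AbelianSTPPCensusTAKnap575EvalA
import Summits.MatrixMultiplication.MatrixMultiplication.Theorems.AbelianSTPPCensusTAKnap575EvalB
import Summits.MatrixMultiplication.MatrixMultiplication.Theorems.AbelianSTPPCensusTAKnap575EvalC
import Summits.MatrixMultiplication.MatrixMultiplication.Theorems.AbelianSTPPCensusTAKnap575EvalD
import Summits.MatrixMultiplication.MatrixMultiplication.Theorems.AbelianSTPPCensusTAKnap575EvalE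
import Summits.MatrixMultiplication.MatrixMultiplication.Theorems.AbelianSTPPCensusLeafTA473Closed

/-!
# T_A/575: no abelian STPP host of order `≤ 575` beats `τ = 2.371` (the knapsack certificate with the three-room energy clause)

Cell mm-stpp (rung F-M1, D-0059/D-0061), T_A = the brief's own threshold «beat the record exponent `2.371`»: for every finite abelian group
`H` with `|H| ≤ 575` and every STPP family `(A_i,B_i,C_i)` in `H` (`IsSTPP`, CKSU 2005 Def. 5.1), `Σ_i (|A_i||B_i||C_i|)^{2.371/3} ≤ |H|` — no
such family certifies `ω < 2.371` through the Cohn–Umans/CKSU packing bound.  Stated on the generic target predicate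
`NoAbelianSTPPHostUpTo (2371/1000) 575` of `AbelianSTPPCensusTargets.lean` (no named leaf is registered for `575`; the planner may add one).
Assembly:
* `|H| ≤ 473`: the landed leaf `noAbelianSTPPHost_2371_473` (`AbelianSTPPCensusLeafTA473Closed.lean`, p471975; itself `≤ 450` by
  `noAbelianSTPPHost_2371_450`, p465173, and `451 … 473` by the vM knapsack certificate `TAKnap473`);
* `474 ≤ |H| ≤ 575`: degenerate and one-member families by `AbelianTECensus.noAbelianSTPPHostUpTo_of_two`; otherwise vM soundness
  `AbelianTECensus.sieveSound` (`IsSTPP ⇒ SieveAdmissible`), E3 soundness `TAKnap575.e3Adm_of_isSTPP` (`IsSTPP ⇒ E3Adm`, one application of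
  `STPPThreeRoomEnergy.three_room_energy` — seat eng-2 g4, p490420 — per member with `2V > |H|`), and the knapsack certificate at universe
  `575` — `TAKnap575.checked_all` chains the six kernel segments `TAKnap575.seg1 … seg6` through `TAKnap575.seg_sound`, and
  `TAKnap575.not_beats_of_checked` turns them into `¬ Beats (2371/1000) M`.
RANGE.  `473` was the exact range of the vM shape sieve at this threshold (`TAKnap.vmCensusTA_false_at_474`: the class `{(6,6,7)², (6,7,6)²,
(7,6,6)²}` is vM-admissible and beating at `474`; it dies under E3, `STPPThreeRoomEnergy.no_667_667_676_676_766_766_at_474`).  With the E3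
clause the one-table knapsack relaxation certifies every order `474 … 575` (worst integer margin `50 411` at `M = 574`, row `V = 280`) and
FIRST FAILS at `576 = 2·288` (row `V = 288 = 6·6·8`, optimum `(6,6,8)³ + (6,6,7)³ + (5,6,8)`), exactly where E3's hypothesis `2V > M` lapses —
the wall of the RELAXATION; whether the instrument vM ∪ E3 itself admits a beating list near `576` is not claimed either way.
WHAT THIS IS NOT: no bound on `ω` (a rung-leaf-class statement, never summit credit); nothing about orders `≥ 576`; nothing about the
`5/2`-threshold lists of the census (`T_E`), `T_D`, or non-abelian hosts.
-/

set_option linter.dupNamespace false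
set_option autoImplicit false

namespace Summit.MatrixMultiplication.MatrixMultiplication.Theorems

namespace TAKnap575

/-! ## All volumes are checked for the orders `474 … 575` (chaining the six kernel segments) -/

/-- Every volume `1 … 575` is `Checked` for the orders `474, …, 575` (`474 + 102 = 576`): the segment evaluations
`seg1 … seg6` chained through `seg_sound` from `inv_row0`. [original] -/
theorem checked_all : ∀ V, 1 ≤ V → V ≤ TAKnap575.Mtop → TAKnap575.Checked 474 102 V := by
  have s1 := seg_sound (lo := 474) (n := 102) (by norm_num) (by simpa using inv_row0) seg1
  have s2 := seg_sound (by norm_num) (by simpa using s1.1) seg2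
  have s3 := seg_sound (by norm_num) (by simpa using s2.1) seg3
  have s4 := seg_sound (by norm_num) (by simpa using s3.1) seg4
  have s5 := seg_sound (by norm_num) (by simpa using s4.1) seg5
  have s6 := loopVR_sound 474 102 125 451 row450 (by norm_num) (by simpa using s5.1) seg6
  intro V h1 h2
  simp only [Mtop] at h2
  rcases Nat.lt_or_ge V 29 with h | h
  · exact s1.2 V h1 (by omega)
  rcases Nat.lt_or_ge V 91 with h' | h'
  · exact s2.2 V h (by omega)
  rcases Nat.lt_or_ge V 231 with h'' | h''
  · exact s3.2 V h' (by omega)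
  rcases Nat.lt_or_ge V 331 with h''' | h'''
  · exact s4.2 V h'' (by omega)
  rcases Nat.lt_or_ge V 451 with h'''' | h''''
  · exact s5.2 V h''' (by omega)
  · exact s6.2 V h'''' (by omega)

/-- **T_A arithmetic exclusion, orders `474 … 575`.** No shape list that is `SieveAdmissible M` (vM) and `E3Adm M` (three-room energy)
with at least two members beats `τ = 2371/1000` at an order `474 ≤ M ≤ 575`. [original] -/
theorem not_beats_2371 (N M : ℕ) (a b c : Fin N → ℕ) (hN : 2 ≤ N) (h1 : 474 ≤ M) (h2 : M ≤ 575)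
    (hS : SieveAdmissible M a b c) (hE : TAKnap575.E3Adm M a b c) : ¬ Beats (2371 / 1000) M a b c :=
  not_beats_of_checked checked_all hN h1 (by omega) (by simpa [Mtop] using h2) hS hE

end TAKnap575

/-- **T_A/575.** No abelian STPP host of order `≤ 575` beats the record exponent `2.371`: `Σ_i (|A_i||B_i||C_i|)^{2.371/3} ≤ |H|` for every
STPP family in every finite abelian group `H` with `|H| ≤ 575` — no such family certifies `ω < 2.371` through the Cohn–Umans/CKSU packing
bound.  Orders `≤ 473`: `noAbelianSTPPHost_2371_473`; orders `474 … 575`: vM soundness `AbelianTECensus.sieveSound`, E3 soundness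
`TAKnap575.e3Adm_of_isSTPP` (`STPPThreeRoomEnergy.three_room_energy`) and the knapsack certificate `TAKnap575.not_beats_2371`; degenerate /
one-member families: `AbelianTECensus.noAbelianSTPPHostUpTo_of_two`.  `575` is the range of the knapsack RELAXATION with the E3 clause (first
failure `576 = 2·288`, on E3's hypothesis boundary), not a located wall of the instrument.
WHAT THIS IS NOT: no bound on `ω`; rung-leaf class (never summit credit); nothing about orders `≥ 576`, the `5/2` lists, or non-abelian hosts.
[original] -/
theorem noAbelianSTPPHostUpTo_2371_575 : NoAbelianSTPPHostUpTo (2371 / 1000) 575 := by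
  classical
  refine AbelianTECensus.noAbelianSTPPHostUpTo_of_two (τ := 2371 / 1000) (by norm_num) (by norm_num) ?_
  intro H _ _ hM N A B C hS hne hN
  by_cases h473 : Fintype.card H ≤ 473
  · exact noAbelianSTPPHost_2371_473 H h473 N A B C hS
  · have hadm := AbelianTECensus.sieveSound H N A B C hS hne
    have he3 := TAKnap575.e3Adm_of_isSTPP hS hne
    have h := TAKnap575.not_beats_2371 N (Fintype.card H) _ _ _ hN (by omega) hM hadm he3
    unfold Beats at h
    rw [not_lt] at h
    simpa [shapeVol] using h

end Summit.MatrixMultiplication.MatrixMultiplication.Theorems
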